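import Mathlib.Probability.Distributions.Gaussian.Multivariate
import Mathlib.MeasureTheory.Integral.Prod
import HarnessLib

/-!
# Disintegration of the standard Gaussian along a unit vector

For a finite-dimensional real inner product space `E`, its standard Gaussian measure
`γ = stdGaussian E` and a unit vector `ω`, the decomposition `v = c ω + y`, `c = ⟪v, ω⟫`,
`y ⊥ ω`, exhibits `γ` as the image of `γ₁ ⊗ γ` (`γ₁ = gaussianReal 0 1`) under
`(c, z) ↦ c ω + (z - ⟪z, ω⟫ ω)`:

* `stdGaussian_eq_map_fibre` — the identity of measures (by characteristic functions:
  `e^{-⟪ω,t⟫²/2} e^{-‖t - ⟪ω,t⟫ω‖²/2} = e^{-‖t‖²/2}`);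
* `lintegral_stdGaussian_fibre`, `integral_stdGaussian_fibre`, `integrable_comp_fibre` — the
  resulting Fubini formulas `∫ F dγ = ∫∫ F(c ω + P_{ω⊥} z) dγ₁(c) dγ(z)`.

Writing the orthogonal component as `P_{ω⊥} z` for a *full* Gaussian vector `z` avoids measures
on the subspace `ωᗮ`. This is the "`v = r₁ω + V₁`, Jacobian `1`" change of variables of
Baranger–Mouhot (Rev. Mat. Iberoam. 21 (2005), proof of Lemma 2.2) in Gaussian form, used for
the fibre decomposition of the hard-sphere Dirichlet form
(`Literature.Analysis.UnboundedOperators.LinearizedBoltzmann`).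
-/

open MeasureTheory ProbabilityTheory Complex
open scoped InnerProductSpace ENNReal

namespace Literature.Probability.Distributions

noncomputable section

variable {E : Type*} [NormedAddCommGroup E] [InnerProductSpace ℝ E]

/-- The fibre map `(c, z) ↦ c ω + (z - ⟪z, ω⟫ ω)` is continuous. [folklore] -/
theorem continuous_fibreMap (ω : E) :
    Continuous fun p : ℝ × E => p.1 • ω + (p.2 - ⟪p.2, ω⟫_ℝ • ω) := by
  fun_prop

/-- Pythagoras along a unit vector: `⟪ω, t⟫² + ‖t - ⟪ω, t⟫ ω‖² = ‖t‖²`. [folklore] -/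
theorem inner_sq_add_norm_sub_sq {ω : E} (hω : ‖ω‖ = 1) (t : E) :
    ⟪ω, t⟫_ℝ ^ 2 + ‖t - ⟪ω, t⟫_ℝ • ω‖ ^ 2 = ‖t‖ ^ 2 := by
  have hωω : ⟪ω, ω⟫_ℝ = 1 := by rw [real_inner_self_eq_norm_sq, hω, one_pow]
  rw [← real_inner_self_eq_norm_sq (t - _), ← real_inner_self_eq_norm_sq t]
  simp only [inner_sub_left, inner_sub_right, inner_smul_left, inner_smul_right, hωω,
    real_inner_comm t ω, RCLike.conj_to_real]
  ring

variable [FiniteDimensional ℝ E] [MeasurableSpace E] [BorelSpace E]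

/-- **The standard Gaussian disintegrates along any unit vector**: for `‖ω‖ = 1`,
`stdGaussian E` is the image of `gaussianReal 0 1 ⊗ stdGaussian E` under
`(c, z) ↦ c ω + (z - ⟪z, ω⟫ ω)` (independent standard Gaussian coordinate along `ω` and standard
Gaussian component in `ωᗮ`). [folklore] -/
theorem stdGaussian_eq_map_fibre {ω : E} (hω : ‖ω‖ = 1) :
    stdGaussian E = ((gaussianReal 0 1).prod (stdGaussian E)).map
      (fun p : ℝ × E => p.1 • ω + (p.2 - ⟪p.2, ω⟫_ℝ • ω)) := by
  haveI : IsProbabilityMeasure (((gaussianReal 0 1).prod (stdGaussian E)).map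
      (fun p : ℝ × E => p.1 • ω + (p.2 - ⟪p.2, ω⟫_ℝ • ω))) :=
    Measure.isProbabilityMeasure_map (continuous_fibreMap ω).aemeasurable
  apply Measure.ext_of_charFun
  funext t
  set a : ℝ := ⟪ω, t⟫_ℝ with ha
  set t' : E := t - a • ω with ht'
  rw [charFun_apply, charFun_apply, integral_map (continuous_fibreMap ω).aemeasurable
    (by fun_prop)]
  have hsplit : ∀ p : ℝ × E,
      cexp ((⟪p.1 • ω + (p.2 - ⟪p.2, ω⟫_ℝ • ω), t⟫_ℝ : ℂ) * I) =
        cexp (((a * p.1 : ℝ) : ℂ) * I) * cexp ((⟪p.2, t'⟫_ℝ : ℂ) * I) := by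
    intro p
    rw [← Complex.exp_add]
    congr 1
    have : ⟪p.1 • ω + (p.2 - ⟪p.2, ω⟫_ℝ • ω), t⟫_ℝ = a * p.1 + ⟪p.2, t'⟫_ℝ := by
      simp only [ha, ht', inner_add_left, inner_sub_left, inner_smul_left, inner_sub_right,
        inner_smul_right, real_inner_comm ω, RCLike.conj_to_real]
      ring
    rw [this]
    push_cast
    ring
  simp_rw [hsplit]
  rw [integral_prod_mul (fun c : ℝ => cexp (((a * c : ℝ) : ℂ) * I))
    (fun z : E => cexp ((⟪z, t'⟫_ℝ : ℂ) * I))]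
  have h1 : ∫ c : ℝ, cexp (((a * c : ℝ) : ℂ) * I) ∂gaussianReal 0 1 = cexp (-(a : ℂ) ^ 2 / 2) := by
    have key : ∀ c : ℝ, cexp (((a * c : ℝ) : ℂ) * I) = cexp ((a : ℂ) * (c : ℂ) * I) := fun c => by
      push_cast
      ring_nf
    simp_rw [key]
    have := charFun_gaussianReal (μ := 0) (v := 1) a
    rw [charFun_apply_real] at this
    refine this.trans ?_
    congr 1
    push_cast
    ring
  have h2 : ∫ z : E, cexp ((⟪z, t'⟫_ℝ : ℂ) * I) ∂stdGaussian E = cexp (-(‖t'‖ : ℂ) ^ 2 / 2) := by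
    rw [← charFun_apply, charFun_stdGaussian]
  rw [h1, h2, ← charFun_apply, charFun_stdGaussian, ← Complex.exp_add]
  congr 1
  have h3 := inner_sq_add_norm_sub_sq hω t
  rw [← ha, ← ht'] at h3
  have h3' : ((a : ℂ) ^ 2 + (‖t'‖ : ℂ) ^ 2) = (‖t‖ : ℂ) ^ 2 := by exact_mod_cast h3
  linear_combination (1 / 2 : ℂ) * h3'

/-- **Fubini along a unit vector, `lintegral` form**: for measurable `F ≥ 0` and `‖ω‖ = 1`,
`∫ F dγ = ∫∫ F(c ω + (z - ⟪z, ω⟫ ω)) dγ(z) dγ₁(c)`. [folklore] -/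
theorem lintegral_stdGaussian_fibre {ω : E} (hω : ‖ω‖ = 1) {F : E → ℝ≥0∞} (hF : Measurable F) :
    ∫⁻ x, F x ∂stdGaussian E =
      ∫⁻ c, ∫⁻ z, F (c • ω + (z - ⟪z, ω⟫_ℝ • ω)) ∂stdGaussian E ∂gaussianReal 0 1 := by
  conv_lhs => rw [stdGaussian_eq_map_fibre hω]
  rw [lintegral_map hF (continuous_fibreMap ω).measurable]
  exact lintegral_prod (fun p : ℝ × E => F (p.1 • ω + (p.2 - ⟪p.2, ω⟫_ℝ • ω)))
    (hF.comp (continuous_fibreMap ω).measurable).aemeasurable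

/-- **Fubini along a unit vector, product form**: for `F` integrable against `γ` and `‖ω‖ = 1`,
`∫ F dγ = ∫ F(c ω + (z - ⟪z, ω⟫ ω)) d(γ₁ ⊗ γ)(c, z)`. [folklore] -/
theorem integral_stdGaussian_fibre {ω : E} (hω : ‖ω‖ = 1) {F : E → ℝ}
    (hF : AEStronglyMeasurable F (stdGaussian E)) :
    ∫ x, F x ∂stdGaussian E =
      ∫ p : ℝ × E, F (p.1 • ω + (p.2 - ⟪p.2, ω⟫_ℝ • ω)) ∂(gaussianReal 0 1).prod (stdGaussian E) := by
  conv_lhs => rw [stdGaussian_eq_map_fibre hω]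
  rw [integral_map (continuous_fibreMap ω).aemeasurable]
  rwa [← stdGaussian_eq_map_fibre hω]

/-- Integrability transfers to the fibre coordinates. [folklore] -/
theorem integrable_comp_fibre {ω : E} (hω : ‖ω‖ = 1) {F : E → ℝ}
    (hF : Integrable F (stdGaussian E)) :
    Integrable (fun p : ℝ × E => F (p.1 • ω + (p.2 - ⟪p.2, ω⟫_ℝ • ω)))
      ((gaussianReal 0 1).prod (stdGaussian E)) := by
  have h := hF
  rw [stdGaussian_eq_map_fibre hω] at h
  exact (integrable_map_measure h.aestronglyMeasurable (continuous_fibreMap ω).aemeasurable).1 h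

/-- **Fubini along a unit vector, iterated form**: for `F` integrable against `γ` and `‖ω‖ = 1`,
`∫ F dγ = ∫ (∫ F(c ω + (z - ⟪z, ω⟫ ω)) dγ(z)) dγ₁(c)`. [folklore] -/
theorem integral_stdGaussian_fibre' {ω : E} (hω : ‖ω‖ = 1) {F : E → ℝ}
    (hF : Integrable F (stdGaussian E)) :
    ∫ x, F x ∂stdGaussian E =
      ∫ c, ∫ z, F (c • ω + (z - ⟪z, ω⟫_ℝ • ω)) ∂stdGaussian E ∂gaussianReal 0 1 := by
  rw [integral_stdGaussian_fibre hω hF.aestronglyMeasurable,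
    integral_prod _ (integrable_comp_fibre hω hF)]

/-- The squared `L²(γ)`-norm in fibre coordinates:
`∫ F² dγ = ∫∫ F(c ω + (z - ⟪z, ω⟫ ω))² dγ₁ dγ` (`lintegral` form, no integrability needed). [folklore] -/
theorem lintegral_sq_stdGaussian_fibre {ω : E} (hω : ‖ω‖ = 1) {F : E → ℝ} (hF : Measurable F) :
    ∫⁻ x, ENNReal.ofReal (F x ^ 2) ∂stdGaussian E =
      ∫⁻ c, ∫⁻ z, ENNReal.ofReal (F (c • ω + (z - ⟪z, ω⟫_ℝ • ω)) ^ 2)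
        ∂stdGaussian E ∂gaussianReal 0 1 :=
  lintegral_stdGaussian_fibre hω ((hF.pow_const 2).ennreal_ofReal)

end

end Literature.Probability.Distributions
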